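import Summits.KontsevichZagierPeriods.KontsevichZagierPeriods.Theorems.LinRedNormalFormArrangementNormalFormStubRebaseOneTools
import Summits.KontsevichZagierPeriods.KontsevichZagierPeriods.Theorems.LinRedNormalFormArrangementNormalFormStubRebaseOneCov

/-!
# Stub `stub_rebaseOne` (crux `ArrangementNormalForm`, line `janus-bands`) — part `Moves`

The moves of `stub_rebaseOne` (skeleton v4 of crux `ArrangementNormalForm`, line `janus-bands`) on
BAND representations `[{y ∈ I, u(y) < t < v(y)}, q(y−μ)^{n₁}/(y−μ)^{n₂} · (1/(t − c(y)))]`: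
the fibred affine pull-back `y = α y' + β, t = t' + s(y)` (shear by an atom `s` and affine base
change: rows, bounds, letter and integrand data transform by explicit rational formulas,
`band_pull`), the reflection `t ↦ −t` (`band_reflect`), the BLOW-UP of a band pinched on its
letter line into a rectangle (`band_blow`), and the TERMINAL moves: a band one of whose bounds is
parallel to the letter (or a letter-free band) is normalised by one pull-back to an element of
`GG 0 2 1` (`good_lowerPar`, `good_upperPar`, `good_noLetter`).

References: M. Kontsevich, D. Zagier, *Periods* (2001), §1.2, rule (2).
-/

noncomputable section

open Set MeasureTheory
open Literature.NumberTheory.Transcendental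
open Literature.ModelTheory.ExponentialFields

namespace Summit.KontsevichZagierPeriods.ArrangementNormalForm.JanusBands

namespace RebaseOne

/-! ### Pulled data -/

/-- A row after the base substitution `y = α y' + β`. -/
def pullRow (α β : ℚ) (q : Aff) : Aff := (α * q.1, β * q.1 + q.2)

/-- A bound or letter after the substitution `y = α y' + β`, `t = t' + s(y)`. -/
def pullAff (α β : ℚ) (s q : Aff) : Aff := pullRow α β (q - s)

/-- Integrand data after the substitution `y = α y' + β` (Jacobian `|α|` included). -/
def pullT (α β : ℚ) (T : IData) : IData :=
  (|α| * T.1 * α ^ T.2.2.1 / α ^ T.2.2.2, ((T.2.1 - β) / α, T.2.2))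

/-- Value of a pulled row. -/
theorem ev_pullRow (α β : ℚ) (q : Aff) (y : ℝ) : ev (pullRow α β q) y = ev q (α * y + β) := by
  simp only [ev, pullRow, Rat.cast_mul, Rat.cast_add]; ring

/-- Value of a pulled bound. -/
theorem ev_pullAff (α β : ℚ) (s q : Aff) (y : ℝ) :
    ev (pullAff α β s q) y = ev q (α * y + β) - ev s (α * y + β) := by
  rw [pullAff, ev_pullRow, ev_sub]

/-- Slope of a pulled bound. -/
theorem pullAff_fst (α β : ℚ) (s q : Aff) : (pullAff α β s q).1 = α * (q.1 - s.1) := rfl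

/-- The normalising substitution makes a bound equal to `y'`. -/
theorem pullAff_norm (s q : Aff) (h : q.1 ≠ s.1) :
    pullAff (q.1 - s.1)⁻¹ (-(q.2 - s.2) * (q.1 - s.1)⁻¹) s q = (1, 0) := by
  have h' : q.1 - s.1 ≠ 0 := sub_ne_zero.2 h
  simp only [pullAff, pullRow, Prod.fst_sub, Prod.snd_sub, Prod.mk.injEq]
  constructor
  · exact inv_mul_cancel₀ h'
  · field_simp; ring

/-- The base factor after substitution. -/
theorem gfun_pull (α β : ℚ) (hα : α ≠ 0) (T : IData) (y : ℝ) :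
    gfun (pullT α β T) y = gfun T (α * y + β) * |(α : ℝ)| := by
  obtain ⟨q, μ, n₁, n₂⟩ := T
  have hα' : (α : ℝ) ≠ 0 := Rat.cast_ne_zero.2 hα
  have key : (α : ℝ) * y + β - μ = α * (y - ((μ - β) / α : ℚ)) := by push_cast; field_simp; ring
  simp only [gfun, pullT, key, mul_pow]
  push_cast
  ring

/-! ### The fibred affine pull-back of a band representation -/

/-- **Affine pull-back of a band.** Under `y = α y' + β`, `t = t' + s(y)` (`α ≠ 0`), a band
representation pulls back to the band representation with pulled rows, bounds, letter and
integrand data, and the two differ by a relation (rule 2). -/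
theorem band_pull {r : KZ.IntegralRep 2} {m : ℕ} {M : Fin m → Aff} {U V : Aff} {T : IData}
    {a : Option Aff} (h : IsBandRep r M U V T a) (α β : ℚ) (hα : α ≠ 0) (s : Aff) :
    ∃ r' : KZ.IntegralRep 2, IsBandRep r' (fun j => pullRow α β (M j)) (pullAff α β s U)
      (pullAff α β s V) (pullT α β T) (a.map (pullAff α β s)) ∧
      KZ.of r - KZ.of r' ∈ KZ.relations := by
  set Ψ := affMap (α : ℝ) (β : ℝ) ((1 : ℚ) : ℝ) ((s.1 * α : ℚ) : ℝ) ((s.1 * β + s.2 : ℚ) : ℝ)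
    with hΨ
  set R := band (baseSet fun j => pullRow α β (M j)) (ev (pullAff α β s U)) (ev (pullAff α β s V))
    with hR
  have hα' : (α : ℝ) ≠ 0 := Rat.cast_ne_zero.2 hα
  have hΨ0 : ∀ z', Ψ z' 0 = α * z' 0 + β := fun z' => rfl
  have hΨ1 : ∀ z', Ψ z' 1 = z' 1 + ev s (α * z' 0 + β) := fun z' => by
    simp only [hΨ, affMap_one, ev]; push_cast; ring
  have hmem : ∀ z', z' ∈ R ↔ Ψ z' ∈ r.domain := fun z' => by
    rw [h.dom]
    simp only [hR, band, baseSet, mem_setOf_eq, hΨ0, hΨ1, ev_pullRow, ev_pullAff]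
    constructor
    · rintro ⟨h1, h2, h3⟩; exact ⟨h1, by linarith, by linarith⟩
    · rintro ⟨h1, h2, h3⟩; exact ⟨h1, by linarith, by linarith⟩
  set Φ : (Fin 2 → ℝ) → (Fin 2 → ℝ) := fun z => ![(z 0 - β) / α, z 1 - ev s (z 0)] with hΦ
  have hΨΦ : ∀ z, Ψ (Φ z) = z := fun z => by
    ext i
    fin_cases i
    · simp [hΨ, hΦ]; field_simp; ring
    · simp [hΨ, hΦ, ev]; field_simp; ring
  have himg : Ψ '' R = r.domain := by
    ext z
    constructor
    · rintro ⟨z', hz', rfl⟩; exact (hmem z').1 hz'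
    · intro hz; exact ⟨Φ z, (hmem _).2 (by rw [hΨΦ]; exact hz), hΨΦ z⟩
  have hint : ∀ z' ∈ R, integ (pullT α β T) (a.map (pullAff α β s)) z' =
      r.integrand (Ψ z') * |(α : ℝ) * (1 : ℚ)| := by
    intro z' hz'
    rw [h.int ((hmem z').1 hz'), Rat.cast_one, mul_one]
    simp only [integ, hΨ0, hΨ1, gfun_pull α β hα]
    cases a with
    | none => simp
    | some c => simp only [Option.map_some, Option.elim_some, ev_pullAff]; ring
  obtain ⟨r', hr'd, hr'i, hrel⟩ := cov_pull_aff r (isSemialgebraic_band _ _ _) α β 1 (s.1 * α)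
    (s.1 * β + s.2) hα one_ne_zero himg _ (isSemialgebraicFunOn_integ (isSemialgebraic_band _ _ _) _ _)
    hint
  refine ⟨r', ⟨hr'd, fun z _ => by rw [hr'i], ?_, h.adm⟩, hrel⟩
  obtain ⟨Rb, hRb0, hRb⟩ := exists_abs_le h.bdd
  rw [hr'd]
  refine isBounded_of_abs_le ((Rb + |(β : ℝ)|) / |(α : ℝ)| + (Rb + (|(s.1 : ℝ)| * Rb + |(s.2 : ℝ)|)))
    fun z' hz' => ?_
  obtain ⟨h0, h1⟩ := hRb _ ((hmem z').1 hz')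
  rw [hΨ0] at h0
  rw [hΨ1] at h1
  have hy : |z' 0| ≤ (Rb + |(β : ℝ)|) / |(α : ℝ)| := by
    rw [le_div_iff₀ (abs_pos.2 hα'), ← abs_mul]
    calc |z' 0 * α| = |(α * z' 0 + β) - β| := by ring_nf
      _ ≤ |α * z' 0 + β| + |(β : ℝ)| := abs_sub _ _
      _ ≤ Rb + |(β : ℝ)| := by linarith
  have hs : |ev s (α * z' 0 + β)| ≤ |(s.1 : ℝ)| * Rb + |(s.2 : ℝ)| := by
    unfold ev
    calc |(s.1 : ℝ) * (α * z' 0 + β) + s.2| ≤ |(s.1 : ℝ) * (α * z' 0 + β)| + |(s.2 : ℝ)| :=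
          abs_add_le _ _
      _ = |(s.1 : ℝ)| * |α * z' 0 + β| + |(s.2 : ℝ)| := by rw [abs_mul]
      _ ≤ |(s.1 : ℝ)| * Rb + |(s.2 : ℝ)| := by gcongr
  have ht : |z' 1| ≤ Rb + (|(s.1 : ℝ)| * Rb + |(s.2 : ℝ)|) := by
    calc |z' 1| = |(z' 1 + ev s (α * z' 0 + β)) - ev s (α * z' 0 + β)| := by ring_nf
      _ ≤ |z' 1 + ev s (α * z' 0 + β)| + |ev s (α * z' 0 + β)| := abs_sub _ _
      _ ≤ Rb + (|(s.1 : ℝ)| * Rb + |(s.2 : ℝ)|) := add_le_add h1 hs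
  exact ⟨hy.trans (le_add_of_nonneg_right (by positivity)),
    ht.trans (le_add_of_nonneg_left (by positivity))⟩

/-- **Reflection `t ↦ −t`** of a lettered band representation (rule 2). -/
theorem band_reflect {r : KZ.IntegralRep 2} {m : ℕ} {M : Fin m → Aff} {U V : Aff} {T : IData}
    {c : Aff} (h : IsBandRep r M U V T (some c)) :
    ∃ r' : KZ.IntegralRep 2, IsBandRep r' M (-V) (-U) (-T.1, T.2) (some (-c)) ∧
      KZ.of r - KZ.of r' ∈ KZ.relations := by
  set Ψ := affMap (1 : ℚ) (0 : ℚ) (-1 : ℚ) (0 : ℚ) (0 : ℚ) with hΨ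
  set R := band (baseSet M) (ev (-V)) (ev (-U)) with hR
  have hΨ0 : ∀ z', Ψ z' 0 = z' 0 := fun z' => by simp [hΨ]
  have hΨ1 : ∀ z', Ψ z' 1 = -z' 1 := fun z' => by simp [hΨ]
  have hmem : ∀ z', z' ∈ R ↔ Ψ z' ∈ r.domain := fun z' => by
    rw [h.dom]
    simp only [hR, band, mem_setOf_eq, hΨ0, hΨ1, ev_neg]
    constructor
    · rintro ⟨h1, h2, h3⟩; exact ⟨h1, by linarith, by linarith⟩
    · rintro ⟨h1, h2, h3⟩; exact ⟨h1, by linarith, by linarith⟩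
  have hΨΨ : ∀ z, Ψ (Ψ z) = z := fun z => by
    ext i
    fin_cases i
    · simp [hΨ]
    · simp [hΨ]
  have himg : Ψ '' R = r.domain := by
    ext z
    constructor
    · rintro ⟨z', hz', rfl⟩; exact (hmem z').1 hz'
    · intro hz; exact ⟨Ψ z, (hmem _).2 (by rw [hΨΨ]; exact hz), hΨΨ z⟩
  have hint : ∀ z' ∈ R, integ (-T.1, T.2) (some (-c)) z' =
      r.integrand (Ψ z') * |((1 : ℚ) : ℝ) * ((-1 : ℚ) : ℝ)| := by
    intro z' hz'
    rw [h.int ((hmem z').1 hz')]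
    simp only [integ, gfun, hΨ0, hΨ1, Option.elim_some, ev_neg, sub_neg_eq_add, Rat.cast_neg,
      Rat.cast_one]
    rw [← neg_add', div_neg]
    norm_num
    ring
  obtain ⟨r', hr'd, hr'i, hrel⟩ := cov_pull_aff r (isSemialgebraic_band _ _ _) 1 0 (-1) 0 0
    one_ne_zero (by norm_num) himg _ (isSemialgebraicFunOn_integ (isSemialgebraic_band _ _ _) _ _) hint
  refine ⟨r', ⟨hr'd, fun z _ => by rw [hr'i], ?_, h.adm⟩, hrel⟩
  obtain ⟨Rb, _, hRb⟩ := exists_abs_le h.bdd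
  rw [hr'd]
  refine isBounded_of_abs_le Rb fun z' hz' => ?_
  obtain ⟨h0, h1⟩ := hRb _ ((hmem z').1 hz')
  rw [hΨ0] at h0
  rw [hΨ1, abs_neg] at h1
  exact ⟨h0, h1⟩

/-- **Blow-up of a band pinched on its letter line** (rule 2 with `(y, s) ↦ (y, c(y) + s (y − p))`):
if both bounds pass through the point `(p, c(p))` of the letter line, `u = c + A (y − p)`,
`v = c + B (y − p)`, and the base cell lies on one side of `p`, the band is the blow-up image of
the RECTANGLE `I × (A, B)` (or `I × (B, A)`), on which the integrand becomes `± g(y)/s`. -/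
theorem band_blow {r : KZ.IntegralRep 2} {m : ℕ} {M : Fin m → Aff} {U V : Aff} {T : IData}
    {c : Aff} (h : IsBandRep r M U V T (some c)) (p A B ε : ℚ) (hε : ε = 1 ∨ ε = -1)
    (hI : ∀ y ∈ baseSet M, 0 < (ε : ℝ) * (y - p) ∧ ev U y < ev V y)
    (hU : ∀ y : ℝ, ev U y = ev c y + A * (y - p)) (hV : ∀ y : ℝ, ev V y = ev c y + B * (y - p)) :
    ∃ r' : KZ.IntegralRep 2, IsBandRep r' M (0, if ε = 1 then A else B) (0, if ε = 1 then B else A)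
      (ε * T.1, T.2) (some 0) ∧ KZ.of r - KZ.of r' ∈ KZ.relations := by
  set lo : ℚ := if ε = 1 then A else B with hlo
  set hi : ℚ := if ε = 1 then B else A with hhi
  set Ψ := blowMap (c.1 : ℝ) (c.2 : ℝ) (p : ℝ) with hΨ
  set R := band (baseSet M) (ev (0, lo)) (ev (0, hi)) with hR
  have hΨ0 : ∀ z', Ψ z' 0 = z' 0 := fun z' => rfl
  have hΨ1 : ∀ z', Ψ z' 1 = ev c (z' 0) + z' 1 * (z' 0 - p) := fun z' => by
    simp only [hΨ, blowMap_one, ev]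
  have hne : ∀ y ∈ baseSet M, (y : ℝ) - p ≠ 0 := fun y hy h0 => by
    have := (hI y hy).1; rw [h0, mul_zero] at this; exact lt_irrefl _ this
  -- fibres: `u(y) < c(y) + s (y - p) < v(y) ↔ lo < s < hi`
  have hfib : ∀ y ∈ baseSet M, ∀ s : ℝ,
      (ev U y < ev c y + s * (y - p) ∧ ev c y + s * (y - p) < ev V y) ↔ ((lo : ℝ) < s ∧ s < hi) := by
    intro y hy s
    rw [hU, hV]
    rcases hε with rfl | rfl
    · have hp : 0 < (y : ℝ) - p := by simpa using (hI y hy).1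
      simp only [hlo, hhi, if_true]
      constructor
      · rintro ⟨h1, h2⟩
        exact ⟨lt_of_mul_lt_mul_right (by linarith) hp.le, lt_of_mul_lt_mul_right (by linarith) hp.le⟩
      · rintro ⟨h1, h2⟩; constructor <;> nlinarith
    · have hp : (y : ℝ) - p < 0 := by have := (hI y hy).1; push_cast at this; linarith
      simp only [hlo, hhi, show ¬((-1 : ℚ) = 1) by norm_num, if_false]
      constructor
      · rintro ⟨h1, h2⟩; constructor <;> nlinarith
      · rintro ⟨h1, h2⟩; constructor <;> nlinarith
  have hmem : ∀ z', z' ∈ R ↔ Ψ z' ∈ r.domain := fun z' => by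
    rw [h.dom]
    simp only [hR, band, mem_setOf_eq, hΨ0, hΨ1, ev_mk, Rat.cast_zero, zero_mul, zero_add]
    constructor
    · rintro ⟨h1, h2⟩; exact ⟨h1, (hfib _ h1 _).2 h2⟩
    · rintro ⟨h1, h2⟩; exact ⟨h1, (hfib _ h1 _).1 h2⟩
  set Φ : (Fin 2 → ℝ) → (Fin 2 → ℝ) := fun z => ![z 0, (z 1 - ev c (z 0)) / (z 0 - p)] with hΦ
  have hΨΦ : ∀ z ∈ r.domain, Ψ (Φ z) = z := fun z hz => by
    have hz0 : z 0 ∈ baseSet M := by rw [h.dom] at hz; exact hz.1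
    ext i
    fin_cases i
    · simp [hΨ, hΦ]
    · simp [hΦ, hΨ1]; field_simp [hne _ hz0]; ring
  have himg : Ψ '' R = r.domain := by
    ext z
    constructor
    · rintro ⟨z', hz', rfl⟩; exact (hmem z').1 hz'
    · intro hz; exact ⟨Φ z, (hmem _).2 (by rw [hΨΦ z hz]; exact hz), hΨΦ z hz⟩
  have habs : ∀ y ∈ baseSet M, |(y : ℝ) - p| = ε * (y - p) := by
    intro y hy
    rcases hε with rfl | rfl
    · have hp : 0 < (y : ℝ) - p := by simpa using (hI y hy).1
      rw [abs_of_pos hp]; simp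
    · have hp : (y : ℝ) - p < 0 := by have := (hI y hy).1; push_cast at this; linarith
      rw [abs_of_neg hp]; simp
  have hint : ∀ z' ∈ R, integ (ε * T.1, T.2) (some 0) z' = r.integrand (Ψ z') * |z' 0 - p| := by
    intro z' hz'
    have hz0 : z' 0 ∈ baseSet M := hz'.1
    rw [h.int ((hmem z').1 hz'), habs _ hz0]
    simp only [integ, gfun, hΨ0, hΨ1, Option.elim_some, ev_zero, sub_zero, Rat.cast_mul,
      add_sub_cancel_left]
    rcases eq_or_ne (z' 1) 0 with h0 | h0
    · simp [h0]
    · field_simp [hne _ hz0]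
  obtain ⟨r', hr'd, hr'i, hrel⟩ := cov_pull_blow r (isSemialgebraic_band _ _ _) c.1 c.2 p
    (fun z' hz' => sub_ne_zero.1 (hne _ hz'.1)) himg _
    (isSemialgebraicFunOn_integ (isSemialgebraic_band _ _ _) _ _) hint
  refine ⟨r', ⟨hr'd, fun z _ => by rw [hr'i], ?_, h.adm⟩, hrel⟩
  obtain ⟨Rb, hRb0, hRb⟩ := exists_abs_le h.bdd
  rw [hr'd]
  refine isBounded_of_abs_le (Rb + (|(A : ℝ)| + |(B : ℝ)|)) fun z' hz' => ?_
  have hz0 : z' 0 ∈ baseSet M := hz'.1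
  have hyD : (![z' 0, (ev U (z' 0) + ev V (z' 0)) / 2] : Fin 2 → ℝ) ∈ r.domain := by
    rw [h.dom]
    have := (hI _ hz0).2
    refine ⟨hz0, ?_, ?_⟩ <;> simp <;> linarith
  have hy : |z' 0| ≤ Rb := (hRb _ hyD).1
  have hs : |z' 1| ≤ |(A : ℝ)| + |(B : ℝ)| := by
    have h2 := hz'.2
    simp only [ev_mk, Rat.cast_zero, zero_mul, zero_add] at h2
    have hloA : |(lo : ℝ)| ≤ |(A : ℝ)| + |(B : ℝ)| := by
      rw [hlo]; split_ifs <;> simp [abs_nonneg]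
    have hhiA : |(hi : ℝ)| ≤ |(A : ℝ)| + |(B : ℝ)| := by
      rw [hhi]; split_ifs <;> simp [abs_nonneg]
    rw [abs_le] at hloA hhiA ⊢
    constructor <;> linarith [h2.1, h2.2]
  exact ⟨hy.trans (le_add_of_nonneg_right (by positivity)), hs.trans (le_add_of_nonneg_left hRb0)⟩

/-! ### Terminal moves -/

/-- A band whose LOWER bound is parallel to its letter is good: shear the letter to `0` and, if
the upper bound is not parallel too, rescale the base to make it `y`. -/
theorem good_lowerPar {r : KZ.IntegralRep 2} {m : ℕ} {M : Fin m → Aff} {U V : Aff} {T : IData}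
    {c : Aff} (h : IsBandRep r M U V T (some c)) (hU : U.1 = c.1) : Good (KZ.of r) := by
  by_cases hV : V.1 = c.1
  · obtain ⟨r', h', hrel⟩ := band_pull h 1 0 one_ne_zero c
    refine good_of_sub_mem hrel (good_of_mem (mem_GGlit h' ?_ (Or.inl ?_) (Or.inl ?_)))
    · rintro c' hc'
      simp only [Option.map_some, Option.some.injEq] at hc'
      rw [← hc', pullAff_fst, sub_self, mul_zero]
    · rw [pullAff_fst, hU, sub_self, mul_zero]
    · rw [pullAff_fst, hV, sub_self, mul_zero]
  · obtain ⟨r', h', hrel⟩ := band_pull h (V.1 - c.1)⁻¹ (-(V.2 - c.2) * (V.1 - c.1)⁻¹)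
      (inv_ne_zero (sub_ne_zero.2 hV)) c
    refine good_of_sub_mem hrel (good_of_mem (mem_GGlit h' ?_ (Or.inl ?_) (Or.inr ?_)))
    · rintro c' hc'
      simp only [Option.map_some, Option.some.injEq] at hc'
      rw [← hc', pullAff_fst, sub_self, mul_zero]
    · rw [pullAff_fst, hU, sub_self, mul_zero]
    · exact pullAff_norm c V hV

/-- A band whose UPPER bound is parallel to its letter is good. -/
theorem good_upperPar {r : KZ.IntegralRep 2} {m : ℕ} {M : Fin m → Aff} {U V : Aff} {T : IData}
    {c : Aff} (h : IsBandRep r M U V T (some c)) (hV : V.1 = c.1) : Good (KZ.of r) := by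
  by_cases hU : U.1 = c.1
  · exact good_lowerPar h hU
  · obtain ⟨r', h', hrel⟩ := band_pull h (U.1 - c.1)⁻¹ (-(U.2 - c.2) * (U.1 - c.1)⁻¹)
      (inv_ne_zero (sub_ne_zero.2 hU)) c
    refine good_of_sub_mem hrel (good_of_mem (mem_GGlit h' ?_ (Or.inr ?_) (Or.inl ?_)))
    · rintro c' hc'
      simp only [Option.map_some, Option.some.injEq] at hc'
      rw [← hc', pullAff_fst, sub_self, mul_zero]
    · exact pullAff_norm c U hU
    · rw [pullAff_fst, hV, sub_self, mul_zero]

/-- A letter-free band is good: shear the lower bound to `0` and rescale the base. -/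
theorem good_noLetter {r : KZ.IntegralRep 2} {m : ℕ} {M : Fin m → Aff} {U V : Aff} {T : IData}
    (h : IsBandRep r M U V T none) : Good (KZ.of r) := by
  by_cases hV : V.1 = U.1
  · obtain ⟨r', h', hrel⟩ := band_pull h 1 0 one_ne_zero U
    refine good_of_sub_mem hrel (good_of_mem (mem_GGlit h' (fun c' hc' => by simp at hc')
      (Or.inl ?_) (Or.inl ?_)))
    · rw [pullAff_fst, sub_self, mul_zero]
    · rw [pullAff_fst, hV, sub_self, mul_zero]
  · obtain ⟨r', h', hrel⟩ := band_pull h (V.1 - U.1)⁻¹ (-(V.2 - U.2) * (V.1 - U.1)⁻¹)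
      (inv_ne_zero (sub_ne_zero.2 hV)) U
    refine good_of_sub_mem hrel (good_of_mem (mem_GGlit h' (fun c' hc' => by simp at hc')
      (Or.inl ?_) (Or.inr ?_)))
    · rw [pullAff_fst, sub_self, mul_zero]
    · exact pullAff_norm U V hV

end RebaseOne

/-- Registered support goal of this file: the base factor under an affine base substitution. -/
theorem rebaseOne_gfun_pull (α β : ℚ) (hα : α ≠ 0) (T : ℚ × ℚ × ℕ × ℕ) (y : ℝ) : RebaseOne.gfun (RebaseOne.pullT α β T) y = RebaseOne.gfun T (α * y + β) * |(α : ℝ)| :=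
  RebaseOne.gfun_pull α β hα T y

end Summit.KontsevichZagierPeriods.ArrangementNormalForm.JanusBands
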